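import Literature.Analysis.FluidPDE.NormalisedPressureFarFieldLimit
import HarnessLib

/-!
# Vocabulary-free cores of Ożański's Lemma 3.5 (properties of the pressure interaction function)

Analysis/FluidPDE support file (serves the formalisation of Scheffer's construction of singular
weak solutions of the Navier–Stokes inequality in the presentation of W. S. Ożański,
arXiv:1709.00602, §3.6, Lemma 3.5 (= Lemma 7 of the held rendering), on the pressure interaction
function `F[v,f] = ∇p[0,f] - ∇p[v,f]` of a structure: (i) the far-field limit
`lim_{x₁→±∞} x₁⁴F₁(x₁,0) = ±(9/4π)∫ v₁²(R⁻¹y) dy =: ±D`, (ii) `F₁` on the axis attains a positive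
maximum `B = F₁(A,0)`, (iv) `F₂(x₁,0) = 0`).

The three statements have cores that do not mention the axisymmetric vocabulary (`u[v,f]`,
`p[v,f]`, structures) at all, and these cores are what is proved here, for the tree's normalised
pressure `p̃ = normalisedPressure`:

* `tendsto_pow_four_mul_sub_fderiv_normalisedPressure_atTop` / `…_atBot` — **core of (i)**: for
  two fields `u₀, u ∈ C²_c(ℝ³; ℝ³)` with the same modulus `|u₀| = |u|` pointwise and `⟨e, u₀⟩ = 0`
  (for `u₀ = u[0,f]`, `u = u[v,f]` one has `|u₀| = f = |u|` and `u[0,f] = f φ̂ ⊥ e = x̂_axis`),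
  `s⁴ (∂ₑp̃[u₀] - ∂ₑp̃[u])(s e) → ±(9/4π) ∫ ⟨e, u(y)⟩² dy` as `s → ±∞` — from the quadrupole limit
  `s⁴∂ₑp̃[w](se) → (3/4π)∫(|w|² - 3⟨e,w⟩²)` (`NormalisedPressureFarFieldLimit`), the `|w|²` terms
  cancelling;
* `fderiv_apply_eq_zero_of_comp_eq` — **core of (iv)**: a function invariant under a continuous
  linear map `R` has `∂ₐf(x) = 0` whenever `R x = x` and `R a = -a` (for `p̃[u[v,f]]`, which is
  invariant under the reflection in a plane containing the axis, this is `F₂ = 0` on the axis);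
* `exists_pos_of_tendsto_pow_four_mul`, `exists_pos_forall_le_of_tendsto_cocompact` — **core of
  (ii)**: a continuous `g : ℝ → ℝ` with `s⁴ g(s) → D > 0` at `+∞` is positive somewhere, and a
  continuous `g → 0` at `±∞` which is positive somewhere attains a positive global maximum.

## Mathlib search

`Continuous.exists_forall_ge'`, `Filter.Tendsto.sub`, `integral_sub`, `fderiv_comp`,
`ContinuousLinearMap.fderiv`, `fderiv_zero_of_not_differentiableAt` (used).

## References

* W. S. Ożański, *On weak solutions to the Navier–Stokes inequality with internal
  singularities*, arXiv:1709.00602 (2017), §3.6, Lemma 3.5 (i), (ii), (iv) (= Lemma 7 of v1).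
  [`Ozanski2017NSISingular`]
* V. Scheffer, *A solution to the Navier–Stokes inequality with an internal singularity*,
  Comm. Math. Phys. 101 (1985), Lemma 4.1. [`Scheffer1985`]
-/

noncomputable section

open MeasureTheory Set Filter Metric Topology Function Real InnerProductSpace
open scoped RealInnerProductSpace ContDiff ENNReal

namespace Literature.Analysis.FluidPDE

/-! ### Core of Lemma 3.5 (i): the far-field limit of a difference of pressure gradients -/

section Difference

-- nested operator types `ℝ³ →L[ℝ] ℝ³ →L[ℝ] ℝ³ →L[ℝ] ℝ`
set_option maxSynthPendingDepth 3

variable {u₀ u : EuclideanSpace ℝ (Fin 3) → EuclideanSpace ℝ (Fin 3)}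

/-- For `u` continuous with compact support, `y ↦ ⟨e, u y⟩²` is integrable. [folklore] -/
theorem integrable_inner_sq_of_hasCompactSupport (hu : Continuous u) (hc : HasCompactSupport u)
    (e : EuclideanSpace ℝ (Fin 3)) : Integrable fun y => ⟪e, u y⟫ ^ 2 :=
  ((continuous_const.inner hu).pow 2).integrable_of_hasCompactSupport
    (HasCompactSupport.intro (K := tsupport u) hc fun y hy => by
      simp [image_eq_zero_of_notMem_tsupport hy])

/-- For `u` continuous with compact support, `y ↦ |u y|²` is integrable. [folklore] -/
theorem integrable_norm_sq_of_hasCompactSupport' (hu : Continuous u) (hc : HasCompactSupport u) :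
    Integrable fun y => ‖u y‖ ^ 2 :=
  (hu.norm.pow 2).integrable_of_hasCompactSupport
    (HasCompactSupport.intro (K := tsupport u) hc fun y hy => by
      simp [image_eq_zero_of_notMem_tsupport hy])

/-- **Core of Ożański's Lemma 3.5 (i), `x₁ → +∞`.** Let `u₀, u ∈ C²_c(ℝ³; ℝ³)` have the same
modulus pointwise, `|u₀(y)| = |u(y)|`, and let `u₀ ⊥ e` pointwise for a unit vector `e`. Then
`s⁴ (∂ₑp̃[u₀](s e) - ∂ₑp̃[u](s e)) → (9/4π) ∫ ⟨e, u(y)⟩² dy` as `s → +∞`.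
(For a structure: `u₀ = u[0,f] = f φ̂`, `u = u[v,f]`, `e` the axis direction, and the limit is
Ożański's `D = (9/4π)∫ v₁²(R⁻¹y) dy`.) [cite: Ozanski2017NSISingular, Lemma 3.5 (i)] -/
theorem tendsto_pow_four_mul_sub_fderiv_normalisedPressure_atTop (h₀ : ContDiff ℝ 2 u₀)
    (hc₀ : HasCompactSupport u₀) (hu : ContDiff ℝ 2 u) (hc : HasCompactSupport u)
    {e : EuclideanSpace ℝ (Fin 3)} (he : ‖e‖ = 1) (hnorm : ∀ y, ‖u₀ y‖ = ‖u y‖)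
    (horth : ∀ y, ⟪e, u₀ y⟫ = 0) :
    Tendsto (fun s : ℝ => s ^ 4 * (fderiv ℝ (normalisedPressure u₀) (s • e) e -
        fderiv ℝ (normalisedPressure u) (s • e) e)) atTop
      (𝓝 ((9 / (4 * π)) * ∫ y, ⟪e, u y⟫ ^ 2)) := by
  have hL2 := integrable_norm_sq_of_hasCompactSupport' hu.continuous hc
  have hI := integrable_inner_sq_of_hasCompactSupport hu.continuous hc e
  -- the two quadrupole limits
  have h1 := tendsto_pow_four_mul_fderiv_normalisedPressure_atTop h₀ hc₀ he
  have h2 := tendsto_pow_four_mul_fderiv_normalisedPressure_atTop hu hc he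
  -- their values
  have hv1 : ∫ y, (‖u₀ y‖ ^ 2 - 3 * ⟪e, u₀ y⟫ ^ 2) = ∫ y, ‖u y‖ ^ 2 :=
    integral_congr_ae (Eventually.of_forall fun y => by
      simp only [hnorm y, horth y]
      ring)
  have hv2 : ∫ y, (‖u y‖ ^ 2 - 3 * ⟪e, u y⟫ ^ 2) = (∫ y, ‖u y‖ ^ 2) - 3 * ∫ y, ⟪e, u y⟫ ^ 2 := by
    rw [← integral_const_mul, ← integral_sub hL2 (hI.const_mul 3)]
  rw [hv1] at h1
  rw [hv2] at h2
  have h := h1.sub h2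
  have hlim : 3 / (4 * π) * (∫ y, ‖u y‖ ^ 2) -
      3 / (4 * π) * ((∫ y, ‖u y‖ ^ 2) - 3 * ∫ y, ⟪e, u y⟫ ^ 2) =
      9 / (4 * π) * ∫ y, ⟪e, u y⟫ ^ 2 := by ring
  rw [hlim] at h
  refine h.congr fun s => ?_
  ring

/-- **Core of Ożański's Lemma 3.5 (i), `x₁ → -∞`**: under the same hypotheses,
`s⁴ (∂ₑp̃[u₀](s e) - ∂ₑp̃[u](s e)) → -(9/4π) ∫ ⟨e, u(y)⟩² dy` as `s → -∞` (Ożański: `-D`).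
[cite: Ozanski2017NSISingular, Lemma 3.5 (i)] -/
theorem tendsto_pow_four_mul_sub_fderiv_normalisedPressure_atBot (h₀ : ContDiff ℝ 2 u₀)
    (hc₀ : HasCompactSupport u₀) (hu : ContDiff ℝ 2 u) (hc : HasCompactSupport u)
    {e : EuclideanSpace ℝ (Fin 3)} (he : ‖e‖ = 1) (hnorm : ∀ y, ‖u₀ y‖ = ‖u y‖)
    (horth : ∀ y, ⟪e, u₀ y⟫ = 0) :
    Tendsto (fun s : ℝ => s ^ 4 * (fderiv ℝ (normalisedPressure u₀) (s • e) e -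
        fderiv ℝ (normalisedPressure u) (s • e) e)) atBot
      (𝓝 (-(9 / (4 * π)) * ∫ y, ⟪e, u y⟫ ^ 2)) := by
  have hne : ‖-e‖ = 1 := by rw [norm_neg, he]
  have horth' : ∀ y, ⟪-e, u₀ y⟫ = 0 := fun y => by rw [inner_neg_left, horth y, neg_zero]
  have h := ((tendsto_pow_four_mul_sub_fderiv_normalisedPressure_atTop h₀ hc₀ hu hc hne hnorm
    horth').comp tendsto_neg_atBot_atTop).neg
  have hval : -(9 / (4 * π) * ∫ y, ⟪-e, u y⟫ ^ 2) = -(9 / (4 * π)) * ∫ y, ⟪e, u y⟫ ^ 2 := by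
    simp only [inner_neg_left, neg_sq]
    ring
  rw [hval] at h
  refine h.congr fun s => ?_
  simp only [comp_apply, neg_smul, smul_neg, neg_neg, map_neg]
  ring

end Difference

/-! ### Core of Lemma 3.5 (iv): a symmetry kills a directional derivative -/

section Symmetry

variable {E : Type*} [NormedAddCommGroup E] [NormedSpace ℝ E]
variable {F : Type*} [NormedAddCommGroup F] [NormedSpace ℝ F]

/-- **Core of Ożański's Lemma 3.5 (iv).** If `f ∘ R = f` for a continuous linear map `R` with
`R x = x` and `R a = -a`, then `∂ₐf(x) = 0` (no differentiability needed: at points where `f` is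
not differentiable the Fréchet derivative is the junk `0`). For the pressure `p̃[u[v,f]]`, which is
invariant under the reflection in a plane through the symmetry axis, this gives `F₂(x₁, 0) = 0`
(`∂ₓ₂p* (x₁,0,x₃) = 0`, Ożański (3.24)–(3.25)). [cite: Ozanski2017NSISingular, Lemma 3.5 (iv)] -/
theorem fderiv_apply_eq_zero_of_comp_eq (R : E →L[ℝ] E) {f : E → F} (hf : f ∘ R = f) {x a : E}
    (hx : R x = x) (ha : R a = -a) : fderiv ℝ f x a = 0 := by
  by_cases hd : DifferentiableAt ℝ f x
  · have hdR : DifferentiableAt ℝ f (R x) := by rwa [hx]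
    have h1 : fderiv ℝ f x a = fderiv ℝ (f ∘ R) x a := by rw [hf]
    rw [fderiv_comp x hdR R.differentiableAt, R.fderiv, ContinuousLinearMap.comp_apply, hx, ha,
      map_neg] at h1
    have h2 : (2 : ℝ) • fderiv ℝ f x a = 0 := by
      rw [two_smul]
      nth_rewrite 1 [h1]
      exact neg_add_cancel _
    exact (smul_eq_zero.1 h2).resolve_left two_ne_zero
  · rw [fderiv_zero_of_not_differentiableAt hd]
    rfl

end Symmetry

/-! ### Core of Lemma 3.5 (ii): a positive maximum on the axis -/

section Maximum

/-- If `s⁴ g(s) → D > 0` as `s → +∞` then `g` is positive at some positive point. [folklore] -/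
theorem exists_pos_of_tendsto_pow_four_mul {g : ℝ → ℝ} {D : ℝ} (hD : 0 < D)
    (h : Tendsto (fun s : ℝ => s ^ 4 * g s) atTop (𝓝 D)) : ∃ s₀ : ℝ, 0 < s₀ ∧ 0 < g s₀ := by
  have hev : ∀ᶠ s in atTop, D / 2 < s ^ 4 * g s := h.eventually (Ioi_mem_nhds (by linarith))
  obtain ⟨s₀, hs₀⟩ := (hev.and (eventually_gt_atTop 0)).exists
  refine ⟨s₀, hs₀.2, ?_⟩
  have h4 : 0 < s₀ ^ 4 := pow_pos hs₀.2 4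
  by_contra hneg
  rw [not_lt] at hneg
  have : s₀ ^ 4 * g s₀ ≤ 0 := mul_nonpos_of_nonneg_of_nonpos h4.le hneg
  linarith [hs₀.1]

/-- **Core of Ożański's Lemma 3.5 (ii).** A continuous `g : ℝ → ℝ` tending to `0` at `±∞` (along
`cocompact ℝ`) and positive at some point attains a positive global maximum: there is `A` with
`0 < g(A)` and `g(s) ≤ g(A)` for all `s` (Ożański: "`F₁` restricted to the `x₁` axis attains a
positive maximum, `B = F₁(A,0) = max F₁(·,0)`", from (i) and the decay (iii)).
[cite: Ozanski2017NSISingular, Lemma 3.5 (ii)] -/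
theorem exists_pos_forall_le_of_tendsto_cocompact {g : ℝ → ℝ} (hg : Continuous g)
    (h0 : Tendsto g (cocompact ℝ) (𝓝 0)) {s₀ : ℝ} (hs₀ : 0 < g s₀) :
    ∃ A : ℝ, 0 < g A ∧ ∀ s, g s ≤ g A := by
  have hev : ∀ᶠ s in cocompact ℝ, g s ≤ g s₀ :=
    (h0.eventually (Iio_mem_nhds hs₀)).mono fun s hs => hs.le
  obtain ⟨A, hA⟩ := hg.exists_forall_ge' s₀ hev
  exact ⟨A, hs₀.trans_le (hA s₀), hA⟩

end Maximum

end Literature.Analysis.FluidPDE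

end
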